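import Summits.KontsevichZagierPeriods.KontsevichZagierPeriods.Theorems.SoloInformedAlgTheorem2D
import HarnessLib

/-!
# The DEN-calculus over `K`: rational integrands with zeros of the denominator (RULE SPLIT₀)

Solo programme `solo-KontsevichZagierPeriods-informed`, session s108, step 1 of THEOREM 2D⁺
(removing the hypothesis "`Q` has no zero on the open square" from THEOREM 2D).

The notion `SoloInformedPresentableDenK Q` quantifies over integral representations whose
integrand agrees with `x ↦ P(x)/Q(x)` on the open cube — with Mathlib's junk value `a/0 = 0` at
the zeros of `Q`.  The rules of the calculus filed so far (`SoloInformedAlgBoxSplit`, …) build the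
transported representations with `soloInformedOfRationalK`, which asks `Q ≠ 0` on the domain.
This file removes that restriction:

* `soloInformed_isSemialgebraicFunOn_aevalK_div₀` — **LEMMA ALG-COEFF₀**: `x ↦ P(x)/Q(x)` (junk
  value `0` where `Q(x) = 0`) is a `ℚ`-semialgebraic function on every `ℚ`-semialgebraic set, for
  all `P, Q ∈ K[x]` (split the set into `{Q ≠ 0}`, where LEMMA ALG-COEFF applies, and `{Q = 0}`,
  where the function is the constant `0`);
* `soloInformedOfRationalK₀` — the representation `∫_σ P/Q` without a non-vanishing hypothesis;
* `soloInformed_presentable_restrict_slabK₀`, **RULE SPLIT₀** `soloInformed_presentableDenK_of_split₀`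
  — rule (2) along a scale move and the cut of the cube at `x_i = c ∈ K`, verbatim as in
  `SoloInformedAlgBoxSplit` but for arbitrary `Q`.

References: Kontsevich–Zagier 2001 §1.1–1.2 (rules (1a), (2)); Bochnak–Coste–Roy 1998,
Prop. 2.2.6 (semialgebraic functions).
-/

noncomputable section

open scoped BigOperators
open MeasureTheory Set
open Literature.NumberTheory.Transcendental Literature.NumberTheory.Transcendental.KZ
open Literature.ModelTheory.ExponentialFields (IsSemialgebraic)

namespace Summit.KontsevichZagierPeriods.KontsevichZagierPeriods.Theorems

variable {K : Type*} [Field K] [Algebra K ℝ] {n : ℕ}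

/-! ## LEMMA ALG-COEFF₀: rational functions with junk value -/

/-- **LEMMA ALG-COEFF₀.**  For all `P, Q ∈ K[x]` (`K` a field of real algebraic numbers) the
function `x ↦ P(x)/Q(x)` — with Mathlib's junk value `0` at the zeros of `Q` — is `ℚ`-semialgebraic
on every `ℚ`-semialgebraic set `s`: on `s ∩ {Q ≠ 0}` it is the quotient of LEMMA ALG-COEFF, on
`s ∩ {Q = 0}` it is the constant `0`, and both pieces are `ℚ`-semialgebraic (sign conditions on
the `ℚ`-semialgebraic function `Q`). [cite: BochnakCosteRoy1998, Prop. 2.2.6] -/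
theorem soloInformed_isSemialgebraicFunOn_aevalK_div₀
    (hK : ∀ c : K, IsAlgebraic ℚ (algebraMap K ℝ c)) {s : Set (Fin n → ℝ)}
    (hs : IsSemialgebraic ℚ s) (P Q : MvPolynomial (Fin n) K) :
    IsSemialgebraicFunOn ℚ s
      (fun x => (MvPolynomial.aeval x P : ℝ) / MvPolynomial.aeval x Q) := by
  set s₁ : Set (Fin n → ℝ) := {x | x ∈ s ∧ (MvPolynomial.aeval x Q : ℝ) < 0} ∪
    {x | x ∈ s ∧ (MvPolynomial.aeval x (-Q) : ℝ) < 0} with hs₁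
  set s₀ : Set (Fin n → ℝ) := {x | x ∈ s ∧ 0 ≤ (MvPolynomial.aeval x Q : ℝ)} ∩
    {x | x ∈ s ∧ 0 ≤ (MvPolynomial.aeval x (-Q) : ℝ)} with hs₀
  have h₁ : IsSemialgebraic ℚ s₁ :=
    (soloInformed_isSemialgebraicFunOn_aevalK hK hs Q).isSemialgebraic_sep_neg.union
      (soloInformed_isSemialgebraicFunOn_aevalK hK hs (-Q)).isSemialgebraic_sep_neg
  have h₀ : IsSemialgebraic ℚ s₀ :=
    (soloInformed_isSemialgebraicFunOn_aevalK hK hs Q).isSemialgebraic_sep_nonneg.inter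
      (soloInformed_isSemialgebraicFunOn_aevalK hK hs (-Q)).isSemialgebraic_sep_nonneg
  have hQ₁ : ∀ x ∈ s₁, (MvPolynomial.aeval x Q : ℝ) ≠ 0 := by
    rintro x (⟨-, hx⟩ | ⟨-, hx⟩)
    · exact hx.ne
    · rw [map_neg] at hx
      exact (neg_lt_zero.1 hx).ne'
  have hQ₀ : ∀ x ∈ s₀, (MvPolynomial.aeval x Q : ℝ) = 0 := by
    rintro x ⟨⟨-, h1⟩, ⟨-, h2⟩⟩
    rw [map_neg] at h2
    linarith
  have hcover : s₁ ∪ s₀ = s := by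
    refine Subset.antisymm ?_ fun x hx => ?_
    · rintro x ((⟨hx, -⟩ | ⟨hx, -⟩) | ⟨⟨hx, -⟩, -⟩) <;> exact hx
    · rcases lt_trichotomy (MvPolynomial.aeval x Q : ℝ) 0 with h | h | h
      · exact Or.inl (Or.inl ⟨hx, h⟩)
      · exact Or.inr ⟨⟨hx, h.ge⟩, ⟨hx, by rw [map_neg, h, neg_zero]⟩⟩
      · exact Or.inl (Or.inr ⟨hx, by rw [map_neg]; exact neg_lt_zero.2 h⟩)
  have hf₁ : IsSemialgebraicFunOn ℚ s₁
      (fun x => (MvPolynomial.aeval x P : ℝ) / MvPolynomial.aeval x Q) :=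
    soloInformed_isSemialgebraicFunOn_aevalK_div hK h₁ P Q hQ₁
  have hf₀ : IsSemialgebraicFunOn ℚ s₀ (fun _ => (0 : ℝ)) := by
    simpa using isSemialgebraicFunOn_natCast h₀ 0
  rw [← hcover]
  exact hf₁.union hf₀ (fun _ _ => rfl) fun x hx => by
    show (MvPolynomial.aeval x P : ℝ) / MvPolynomial.aeval x Q = 0
    rw [hQ₀ x hx, div_zero]

/-- The integral representation `∫_σ P/Q`, `P, Q ∈ K[x]`, on a `ℚ`-semialgebraic `σ` on which the
(junk-valued) quotient is absolutely integrable — no non-vanishing hypothesis on `Q`.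
[cite: KontsevichZagier2001, §1.1] -/
def soloInformedOfRationalK₀ (hK : ∀ c : K, IsAlgebraic ℚ (algebraMap K ℝ c))
    (σ : Set (Fin n → ℝ)) (p q : MvPolynomial (Fin n) K) (hσ : IsSemialgebraic ℚ σ)
    (hint : IntegrableOn (fun x => (MvPolynomial.aeval x p : ℝ) / MvPolynomial.aeval x q) σ) :
    IntegralRep n where
  domain := σ
  integrand x := MvPolynomial.aeval x p / MvPolynomial.aeval x q
  isSemialgebraic_domain := hσ
  isSemialgebraicFunOn_integrand := soloInformed_isSemialgebraicFunOn_aevalK_div₀ hK hσ p q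
  integrableOn := hint

/-- The domain of `soloInformedOfRationalK₀`. -/
@[simp] theorem soloInformedOfRationalK₀_domain (hK : ∀ c : K, IsAlgebraic ℚ (algebraMap K ℝ c))
    (σ : Set (Fin n → ℝ)) (p q : MvPolynomial (Fin n) K) (hσ : IsSemialgebraic ℚ σ)
    (hint : IntegrableOn (fun x => (MvPolynomial.aeval x p : ℝ) / MvPolynomial.aeval x q) σ) :
    (soloInformedOfRationalK₀ hK σ p q hσ hint).domain = σ := rfl

/-- The integrand of `soloInformedOfRationalK₀` is `p/q`. -/
@[simp] theorem soloInformedOfRationalK₀_integrand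
    (hK : ∀ c : K, IsAlgebraic ℚ (algebraMap K ℝ c))
    (σ : Set (Fin n → ℝ)) (p q : MvPolynomial (Fin n) K) (hσ : IsSemialgebraic ℚ σ)
    (hint : IntegrableOn (fun x => (MvPolynomial.aeval x p : ℝ) / MvPolynomial.aeval x q) σ) :
    (soloInformedOfRationalK₀ hK σ p q hσ hint).integrand =
      fun x => (MvPolynomial.aeval x p : ℝ) / MvPolynomial.aeval x q := rfl

/-! ## Rule (2) along a scale move, arbitrary denominator -/

/-- **Rule (2) along a scale move**, `K`-coefficients, no non-vanishing hypothesis.  If the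
rescaled denominator `scaleSubstK i a b Q` is a presentable denominator, then the restriction to
the slab of `Λ_{i,a,b}` of every `IntegralRep` on `(0,1)ⁿ` with integrand `P/Q` is presentable
(pull back along `Λ_{i,a,b}`, Jacobian `b`; the pulled-back integrand `b·P(Λx)/Q(Λx)` is
`ℚ`-semialgebraic by LEMMA ALG-COEFF₀). [this work] -/
theorem soloInformed_presentable_restrict_slabK₀
    (hK : ∀ c : K, IsAlgebraic ℚ (algebraMap K ℝ c)) (i : Fin n) {a b : K}
    (ha : 0 ≤ algebraMap K ℝ a) (hb : 0 < algebraMap K ℝ b)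
    (hab : algebraMap K ℝ a + algebraMap K ℝ b ≤ 1) (P Q : MvPolynomial (Fin n) K)
    (hS : SoloInformedPresentableDenK (soloInformedScaleSubstK i a b Q)) (ρ : IntegralRep n)
    (hρi : EqOn ρ.integrand (fun x => (MvPolynomial.aeval x P : ℝ) / MvPolynomial.aeval x Q)
      (soloInformedOpenCube n))
    (hD : soloInformedSlabR i (algebraMap K ℝ a) (algebraMap K ℝ b) ⊆ ρ.domain) :
    of (ρ.restrict (soloInformedSlabR i (algebraMap K ℝ a) (algebraMap K ℝ b))
      (isSemialgebraic_soloInformedSlabK hK i a b) hD) ∈ soloInformedPresentable := by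
  set α : ℝ := algebraMap K ℝ a with hαdef
  set β : ℝ := algebraMap K ℝ b with hβdef
  have hmeas : MeasurableSet (soloInformedOpenCube n) := by
    rw [soloInformedOpenCube_eq_pi]; exact MeasurableSet.univ_pi fun _ => measurableSet_Ioo
  have hderiv : ∀ x ∈ soloInformedOpenCube n, HasFDerivWithinAt (soloInformedScaleMoveR i α β)
      (soloInformedScaleDerivR i β) (soloInformedOpenCube n) x :=
    fun x _ => (soloInformed_hasFDerivAt_scaleMoveR i α β x).hasFDerivWithinAt
  have hinj : InjOn (soloInformedScaleMoveR i α β) (soloInformedOpenCube n) :=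
    (soloInformed_scaleMoveR_injective i hb.ne').injOn
  have habs : |(soloInformedScaleDerivR i β).det| = β := by
    rw [soloInformed_det_scaleDerivR]; exact abs_of_pos hb
  have hdom : (ρ.restrict (soloInformedSlabR i α β) (isSemialgebraic_soloInformedSlabK hK i a b)
      hD).domain = soloInformedScaleMoveR i α β '' soloInformedOpenCube n := by
    rw [soloInformed_image_scaleMoveR i ha hb hab]; rfl
  have hform : ∀ x ∈ soloInformedOpenCube n,
      (MvPolynomial.aeval x (MvPolynomial.C b * soloInformedScaleSubstK i a b P) : ℝ) /
          MvPolynomial.aeval x (soloInformedScaleSubstK i a b Q) =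
        ρ.integrand (soloInformedScaleMoveR i α β x) * |(soloInformedScaleDerivR i β).det| :=
    fun x hx => by
      rw [habs, hρi (soloInformed_scaleMoveR_mem i ha hb hab hx).1, map_mul, MvPolynomial.aeval_C,
        soloInformed_aeval_scaleSubstK, soloInformed_aeval_scaleSubstK]
      ring
  have hint1 : IntegrableOn (fun x => |(soloInformedScaleDerivR i β).det| •
      ρ.integrand (soloInformedScaleMoveR i α β x)) (soloInformedOpenCube n) := by
    have h := (ρ.restrict (soloInformedSlabR i α β) (isSemialgebraic_soloInformedSlabK hK i a b)
      hD).integrableOn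
    rw [hdom, integrableOn_image_iff_integrableOn_abs_det_fderiv_smul volume hmeas hderiv hinj]
      at h
    exact h
  have hint' : IntegrableOn (fun x =>
      (MvPolynomial.aeval x (MvPolynomial.C b * soloInformedScaleSubstK i a b P) : ℝ) /
        MvPolynomial.aeval x (soloInformedScaleSubstK i a b Q)) (soloInformedOpenCube n) :=
    hint1.congr_fun (fun x hx => by
      show |(soloInformedScaleDerivR i β).det| • ρ.integrand (soloInformedScaleMoveR i α β x) = _
      rw [hform x hx, smul_eq_mul, mul_comm]) hmeas
  set ρt := soloInformedOfRationalK₀ hK (soloInformedOpenCube n)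
      (MvPolynomial.C b * soloInformedScaleSubstK i a b P) (soloInformedScaleSubstK i a b Q)
      (isSemialgebraic_soloInformedOpenCube n) hint' with hρt
  have h2 : of ρt - of (ρ.restrict (soloInformedSlabR i α β)
      (isSemialgebraic_soloInformedSlabK hK i a b) hD) ∈ relations := by
    refine changeOfVariablesRel_subset_relations ⟨n, ρt, _, soloInformedScaleMoveR i α β,
      fun _ => soloInformedScaleDerivR i β,
      soloInformed_isSemialgebraicMapOn_scaleMoveK hK i a b (isSemialgebraic_soloInformedOpenCube n),
      hderiv, hinj, hdom, fun x hx => ?_, rfl⟩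
    have hx' : x ∈ soloInformedOpenCube n := hx
    show (MvPolynomial.aeval x (MvPolynomial.C b * soloInformedScaleSubstK i a b P) : ℝ) /
        MvPolynomial.aeval x (soloInformedScaleSubstK i a b Q) = _
    exact hform x hx'
  have hpres : of ρt ∈ soloInformedPresentable :=
    hS (MvPolynomial.C b * soloInformedScaleSubstK i a b P) ρt subset_rfl
      (soloInformedOpenCube_subset_cube n) fun _ _ => rfl
  rw [← neg_sub] at h2
  exact soloInformed_presentable_of_sub_mem (by simpa using relations.neg_mem h2) hpres

/-! ## RULE SPLIT₀ -/

/-- **RULE SPLIT₀ over `K`.**  Let `c ∈ K` with `0 < c < 1` in `ℝ`, and let `Q ∈ K[x]` be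
arbitrary.  If both rescaled halves `Q(…, c·x_i, …)` and `Q(…, c + (1−c)·x_i, …)` are presentable
denominators, then so is `Q`: rule (1a) along the null hyperplane `x_i = c` and rule (2) along the
two scale moves. [this work] -/
theorem soloInformed_presentableDenK_of_split₀
    (hK : ∀ c : K, IsAlgebraic ℚ (algebraMap K ℝ c)) (i : Fin n) (c : K)
    (hc0 : 0 < algebraMap K ℝ c) (hc1 : algebraMap K ℝ c < 1) {Q : MvPolynomial (Fin n) K}
    (h₁ : SoloInformedPresentableDenK (soloInformedScaleSubstK i 0 c Q))
    (h₂ : SoloInformedPresentableDenK (soloInformedScaleSubstK i c (1 - c) Q)) :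
    SoloInformedPresentableDenK Q := by
  have h0 : algebraMap K ℝ (0 : K) = 0 := map_zero _
  have h1c : algebraMap K ℝ (1 - c) = 1 - algebraMap K ℝ c := by rw [map_sub, map_one]
  refine soloInformed_presentableDenK_of_open Q fun P ρ hρ hρi => ?_
  have hD₁ : soloInformedSlabR i (algebraMap K ℝ 0) (algebraMap K ℝ c) ⊆ ρ.domain := by
    rw [hρ]; exact soloInformedSlabR_subset_openCube i _ _
  have hD₂ : soloInformedSlabR i (algebraMap K ℝ c) (algebraMap K ℝ (1 - c)) ⊆ ρ.domain := by
    rw [hρ]; exact soloInformedSlabR_subset_openCube i _ _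
  refine soloInformed_presentable_of_cover ρ (isSemialgebraic_soloInformedSlabK hK i 0 c)
    (isSemialgebraic_soloInformedSlabK hK i c (1 - c)) hD₁ hD₂ ?_ ?_
    (soloInformed_presentable_restrict_slabK₀ hK i (by rw [h0]) hc0
      (by rw [h0, zero_add]; exact hc1.le) P Q h₁ ρ hρi hD₁)
    (soloInformed_presentable_restrict_slabK₀ hK i hc0.le (by rw [h1c]; linarith)
      (by rw [h1c]; linarith) P Q h₂ ρ hρi hD₂)
  · refine measure_mono_null (fun x hx => ?_) (measure_empty (μ := volume (α := Fin n → ℝ)))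
    have h1 := hx.1.2.2
    have h2 := hx.2.2.1
    rw [h0, zero_add] at h1
    exact absurd (h1.trans h2) (lt_irrefl (x i))
  · refine measure_mono_null (fun x hx => ?_)
      (soloInformed_volume_hyperplane i (algebraMap K ℝ c))
    have hxO : x ∈ soloInformedOpenCube n := hρ ▸ hx.1
    by_contra hne
    rcases lt_or_gt_of_ne hne with hlt | hgt
    · exact hx.2 (Or.inl ⟨hxO, by rw [h0]; exact (hxO i).1, by rwa [h0, zero_add]⟩)
    · exact hx.2 (Or.inr ⟨hxO, hgt, by rw [h1c]; linarith [(hxO i).2]⟩)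

end Summit.KontsevichZagierPeriods.KontsevichZagierPeriods.Theorems
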